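import Mathlib
import HarnessLib
import Summits.AtomisticToContinuum.FouriersLaw.Theses.JunctionLocality
import Summits.AtomisticToContinuum.FouriersLaw.Theorems.JunctionLocalityDefs

/-!
# Crux `ConductanceLowerBound` (stmt-AtomisticToContinuum-11749), line `kick-dipole-no-collapse`, stub (E) — helper 4:
# the escape floor (E) reduced to an `N`-uniform early bound (U) and a late floor (F)

Helper file toward the registered stub `stub_escapeFloor` (E) (lead c1).  The stub reads, for the booked dipole
`𝔇_N(t) = bookedDipole P N T t` of `Theorems/JunctionLocalityDefs.lean`:

  (E)  `∃ t₁ > 0 ∀ t₀ ∈ (0,t₁] ∃ θ₀ > 0 ∃ τ₀ ∀ τ ≥ τ₀ ∃ N₁ ∀ N ≥ N₁, θ₀·𝔇_N(t₀) ≤ 𝔇_N(τ)`.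

This file isolates, by pure real analysis (`helper_kdEscapeFloorReduction`, stated for EVERY chain `P` and every `T`),
the two inputs (E) is made of:

  (U)  EARLY `N`-UNIFORM UPPER BOUND: `∃ t₁ > 0 ∀ t ∈ (0,t₁] ∃ M ∃ N₀ ∀ N ≥ N₀, 𝔇_N(t) ≤ M` — the booked dipole of long
       chains at small fixed times is bounded above uniformly in the length (content: almost-finite propagation speed,
       `Σ_i |⟨p_0² − T, κ_s j_i⟩_{μ_T}|` summable uniformly in `N` for `s ≤ t₁`; implied by the fixed-time locality
       `𝔇_N(t) → 𝔇_∞(t)`, `eventuallyBounded_of_tendsto`);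
  (F)  LATE FLOOR, `N → ∞` FIRST: `∃ c > 0 ∃ τ₀ ∀ τ ≥ τ₀ ∃ N₁ ∀ N ≥ N₁, c ≤ 𝔇_N(τ)` — at every late fixed time the
       booked dipole of all sufficiently long chains exceeds a fixed positive constant (content: the semi-infinite
       chain with one bath does not hand a contact heat kick entirely back: `inf_{τ ≥ τ₀} 𝔇_∞(τ) > 0`, the
       infinite-volume positivity input of the line; no printed proof for the anharmonic chain).

`(U) ∧ (F) ⟹ (E)` with `θ₀ = c / max M 1`; conversely, given the line's short-time floor (S) (`m ≤ 𝔇_N(t₀)` for all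
`N ≥ 2`), (E) gives back (F) with `c = θ₀ m`, so (F) is EXACTLY the content of (E) beyond (U).  Nothing here is specific
to the pinned chain: the lemma is bookkeeping on real sequences, recorded so that the two inputs have kernel-checked
signatures.
-/

noncomputable section

open MeasureTheory Filter Topology Set
open Literature.MathematicalPhysics.KineticTheory.HeatConduction
open Summit.AtomisticToContinuum.FouriersLaw.Theorems.JunctionLocality

namespace Summit.AtomisticToContinuum.FouriersLaw.Cruxes.ConductanceLowerBound.KickDipoleNoCollapse

/-- **A convergent sequence of booked dipoles is eventually bounded above** (so the fixed-time locality
`𝔇_N(t) → 𝔇_∞(t)` supplies input (U) of `helper_kdEscapeFloorReduction`). -/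
theorem eventuallyBounded_of_tendsto (P : OscillatorChain) (T t : ℝ) {d : ℝ}
    (h : Tendsto (fun N : ℕ => bookedDipole P N T t) atTop (𝓝 d)) :
    ∃ M : ℝ, ∃ N₀ : ℕ, ∀ N : ℕ, N₀ ≤ N → bookedDipole P N T t ≤ M := by
  have hev : ∀ᶠ N : ℕ in atTop, bookedDipole P N T t ≤ d + 1 :=
    (h.eventually (Iic_mem_nhds (lt_add_one d))).mono fun N hN => hN
  obtain ⟨N₀, hN₀⟩ := eventually_atTop.1 hev
  exact ⟨d + 1, N₀, hN₀⟩

/-- **A floor on the limits is a floor eventually in `N`** (so `inf_{τ ≥ τ₀} 𝔇_∞(τ) > 0` together with the fixed-time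
locality supplies input (F) of `helper_kdEscapeFloorReduction`): if `𝔇_N(τ) → d_τ` and `2c ≤ d_τ` then `c ≤ 𝔇_N(τ)`
for all large `N` (`c > 0`). -/
theorem eventuallyFloor_of_tendsto (P : OscillatorChain) (T τ : ℝ) {c d : ℝ} (hc : 0 < c) (hd : 2 * c ≤ d)
    (h : Tendsto (fun N : ℕ => bookedDipole P N T τ) atTop (𝓝 d)) :
    ∃ N₁ : ℕ, ∀ N : ℕ, N₁ ≤ N → c ≤ bookedDipole P N T τ := by
  have hev : ∀ᶠ N : ℕ in atTop, c ≤ bookedDipole P N T τ :=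
    (h.eventually (Ici_mem_nhds (show c < d by linarith))).mono fun N hN => hN
  exact eventually_atTop.1 hev

/-- **helper — THE ESCAPE FLOOR (E) FROM AN EARLY `N`-UNIFORM BOUND (U) AND A LATE FLOOR (F).**  For every chain `P` and
every `T`: if (U) for some `t₁ > 0` every `t ∈ (0, t₁]` admits `M, N₀` with `bookedDipole P N T t ≤ M` for `N ≥ N₀`, and
(F) there are `c > 0` and `τ₀` such that every `τ ≥ τ₀` admits `N₁` with `c ≤ bookedDipole P N T τ` for `N ≥ N₁`, then
the registered escape floor (E) holds: for `t₀ ∈ (0, t₁]` take `θ₀ = c / max M 1` and the `τ₀` of (F); for `τ ≥ τ₀` and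
`N ≥ max N₀ N₁`, `θ₀·𝔇_N(t₀) ≤ θ₀·max M 1 = c ≤ 𝔇_N(τ)`.  Pure real analysis; (F) is the infinite-volume positivity
content of (E), (U) its light-cone content. -/
theorem helper_kdEscapeFloorReduction : ∀ (P : OscillatorChain) (T : ℝ), (∃ t₁ : ℝ, 0 < t₁ ∧ ∀ t : ℝ, 0 < t → t ≤ t₁ → ∃ M : ℝ, ∃ N₀ : ℕ, ∀ N : ℕ, N₀ ≤ N → bookedDipole P N T t ≤ M) → (∃ c : ℝ, 0 < c ∧ ∃ τ₀ : ℝ, ∀ τ : ℝ, τ₀ ≤ τ → ∃ N₁ : ℕ, ∀ N : ℕ, N₁ ≤ N → c ≤ bookedDipole P N T τ) → ∃ t₁ : ℝ, 0 < t₁ ∧ ∀ t₀ : ℝ, 0 < t₀ → t₀ ≤ t₁ → ∃ θ₀ : ℝ, 0 < θ₀ ∧ ∃ τ₀ : ℝ, ∀ τ : ℝ, τ₀ ≤ τ → ∃ N₁ : ℕ, ∀ N : ℕ, N₁ ≤ N → θ₀ * bookedDipole P N T t₀ ≤ bookedDipole P N T τ := by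
  intro P T hU hF
  obtain ⟨t₁, ht₁, hU⟩ := hU
  obtain ⟨c, hc, τ₀, hF⟩ := hF
  refine ⟨t₁, ht₁, fun t₀ ht₀ ht₀₁ => ?_⟩
  obtain ⟨M, N₀, hM⟩ := hU t₀ ht₀ ht₀₁
  have hM1 : 0 < max M 1 := lt_of_lt_of_le one_pos (le_max_right M 1)
  refine ⟨c / max M 1, div_pos hc hM1, τ₀, fun τ hτ => ?_⟩
  obtain ⟨N₁, hN₁⟩ := hF τ hτ
  refine ⟨max N₀ N₁, fun N hN => ?_⟩
  have h1 : bookedDipole P N T t₀ ≤ max M 1 := (hM N (le_trans (le_max_left _ _) hN)).trans (le_max_left M 1)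
  have h2 : c ≤ bookedDipole P N T τ := hN₁ N (le_trans (le_max_right _ _) hN)
  have h3 : c / max M 1 * bookedDipole P N T t₀ ≤ c / max M 1 * max M 1 :=
    mul_le_mul_of_nonneg_left h1 (div_pos hc hM1).le
  rw [div_mul_cancel₀ c hM1.ne'] at h3
  exact h3.trans h2

/-- **The `N → ∞`-first form of the reduction**: fixed-time locality of the booked dipole at every positive time
(`𝔇_N(t) → 𝔇_∞(t)`, the light-cone half of (E)) together with a positive floor `2c ≤ 𝔇_∞(τ)` at all late times `τ ≥ τ₀`
(the semi-infinite escape floor) imply the registered escape floor (E). -/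
theorem helper_kdEscapeFloorOfLocality : ∀ (P : OscillatorChain) (T : ℝ) (Dinf : ℝ → ℝ), (∀ t : ℝ, 0 < t → Tendsto (fun N : ℕ => bookedDipole P N T t) atTop (𝓝 (Dinf t))) → (∃ c : ℝ, 0 < c ∧ ∃ τ₀ : ℝ, 0 < τ₀ ∧ ∀ τ : ℝ, τ₀ ≤ τ → 2 * c ≤ Dinf τ) → ∃ t₁ : ℝ, 0 < t₁ ∧ ∀ t₀ : ℝ, 0 < t₀ → t₀ ≤ t₁ → ∃ θ₀ : ℝ, 0 < θ₀ ∧ ∃ τ₀ : ℝ, ∀ τ : ℝ, τ₀ ≤ τ → ∃ N₁ : ℕ, ∀ N : ℕ, N₁ ≤ N → θ₀ * bookedDipole P N T t₀ ≤ bookedDipole P N T τ := by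
  intro P T Dinf hloc hfloor
  refine helper_kdEscapeFloorReduction P T ⟨1, one_pos, fun t ht _ => eventuallyBounded_of_tendsto P T t (hloc t ht)⟩ ?_
  obtain ⟨c, hc, τ₀, hτ₀, hfl⟩ := hfloor
  refine ⟨c, hc, τ₀, fun τ hτ => ?_⟩
  exact eventuallyFloor_of_tendsto P T τ hc (hfl τ hτ) (hloc τ (lt_of_lt_of_le hτ₀ hτ))

end Summit.AtomisticToContinuum.FouriersLaw.Cruxes.ConductanceLowerBound.KickDipoleNoCollapse

end
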